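import Mathlib
import Summits.NavierStokesRegularity.NavierStokesRegularity.Theorems.RootDecompLitSliceGeneralWindowTradeoffWindowReduction
import Summits.NavierStokesRegularity.NavierStokesRegularity.Theorems.RootDecompLitSliceGeneralWindowTradeoffStubEnergyDrop
import HarnessLib

/-!
# Route RootDecompLitSlice — cell Uᶜ `CritTameScarIsCritical` (stmt-NavierStokesRegularity-31733):
# the SUP-RATE–CLOCK scar law (a third dial: the sup-norm blow-up rate)

Helpers toward Uᶜ (`--supports 31733`, no item). The scar bound at the blow-up time is always
`∫_{B_r(x₀)}|u(T)|² ≤ 2·‖u(t) − u(T)‖₂² + 2·∫_{B_r(x₀)}|u(t)|²` for ANY earlier smooth slice `u(t)`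
(`scar_le_two_clock_add_two_localMass` — the abstract APPROXIMATION PRINCIPLE behind every closed
sub-cell of Uᶜ: the clock pays the first term, some a-priori control of the smooth slice pays the
second, and one optimises `t = t(r)`). The energy–clock rectangle (datum η) pays the second term with
the ENERGY DROP (Hardy on balls + mean dissipation); here it is paid with the SUP-NORM RATE:

* `supRateClockScarRung` — on the Leray–Hopf frame, clock `‖u(t) − u(T)‖₂² ≤ K(T−t)^b` and sup-rate
  `‖u(t)‖_∞ ≤ A(T−t)^{−ρ}` near `T` give `∫_{B_r(x₀)}|u(T)|² ≤ C' r^{3b/(2ρ+b)}` for small `r`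
  (window `T − t = r^{3/(2ρ+b)}`, `|B_r| = 4πr³/3`);
* `criticalScar_of_supRateClock` — CRITICAL scars (`r⁻¹∫_{B_r}|u(T)|² ≤ M`) as soon as `ρ ≤ b`;
* `supRateClockCell` — the literal sub-cell of U/Uᶜ on the maximal-smooth frame: «a tame first
  blow-up with clock exponent `b ≥ 1/2` and sup-rate exponent `ρ ≤ b` has critical scars»
  (`critClock_of_clock_ge_half`: clocks `b ≥ 1/2` lie inside Uᶜ's critical-clock class).

READING (third coordinate of the cell's map). Type I is `ρ = 1/2` (then `b ≥ 1/2` suffices: the known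
Type-I corner, Leslie–Shvydkoy); the Leray floor forces `ρ ≥ 1/2` at a genuine blow-up, so on the
critical clock `b = 1/2` itself the dial adds nothing beyond Type I, but for clocks `b ∈ (1/2, 2/3)` it
closes the MILDLY TYPE-II cells `{1/2 < ρ ≤ b}` which the energy–clock law (needs `a ≥ 1 − b`) does not
see (no relation between the sup-rate `ρ` and the energy exponent `a` is known). Net open content of
Uᶜ after g36: critically clocked (`1/2 ≤ b < 2/3`), energy-rough (`a < 1 − b`) AND strongly Type II
(`ρ > b`).

HONEST FRAMING: helpers INSIDE the Tao-vacuous cell Uᶜ; no item, no node, no load of any route moves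
(ROOT ⟺ U ∧ P1, critic rows 354/371/563/639). Rung 0: nothing here proves NS regularity.
Decomp-ns route-writer g36. [folklore]
-/

set_option linter.dupNamespace false

noncomputable section

namespace Summit.NavierStokesRegularity.NavierStokesRegularity.Theorems

open MeasureTheory Set Metric Filter Topology
open scoped ENNReal
open Literature.Analysis.FluidPDE
open GeneralWindowTradeoff GeneralWindowTradeoff.WindowReduction GeneralWindowTradeoff.EnergyDrop

namespace SupRateClockScarLaw

/-- Real volume of a ball of `ℝ³`: `|B_r| = 4πr³/3`. [folklore] -/
theorem volume_real_ball_fin_three (x₀ : EuclideanSpace ℝ (Fin 3)) {r : ℝ} (hr : 0 ≤ r) :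
    (volume (ball x₀ r)).toReal = 4 * Real.pi / 3 * r ^ 3 := by
  rw [EuclideanSpace.volume_ball_fin_three, ENNReal.toReal_mul, ← ENNReal.ofReal_pow hr,
    ENNReal.toReal_ofReal (by positivity), ENNReal.toReal_ofReal (by positivity)]
  ring

/-- Local mass of a bounded `L²` field: `∫_{B_r(x₀)}‖f‖² ≤ (4πr³/3)·A²` if `‖f‖ ≤ A` pointwise.
[folklore] -/
theorem setIntegral_ball_norm_sq_le_of_bound (f : EuclideanSpace ℝ (Fin 3) → EuclideanSpace ℝ (Fin 3))
    (hf : MemLp f 2 volume) (x₀ : EuclideanSpace ℝ (Fin 3)) {r A : ℝ} (hr : 0 ≤ r)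
    (hb : ∀ x, ‖f x‖ ≤ A) :
    ∫ x in ball x₀ r, ‖f x‖ ^ 2 ≤ 4 * Real.pi / 3 * r ^ 3 * A ^ 2 := by
  have hfin : volume (ball x₀ r) < ⊤ := measure_ball_lt_top
  have hint : IntegrableOn (fun x => ‖f x‖ ^ 2) (ball x₀ r) volume :=
    (hf.integrable_norm_pow two_ne_zero).integrableOn
  have hc : IntegrableOn (fun _ => A ^ 2) (ball x₀ r) volume := integrableOn_const hfin.ne
  calc ∫ x in ball x₀ r, ‖f x‖ ^ 2 ≤ ∫ _ in ball x₀ r, A ^ 2 :=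
        setIntegral_mono hint hc fun x => pow_le_pow_left₀ (norm_nonneg _) (hb x) 2
    _ = 4 * Real.pi / 3 * r ^ 3 * A ^ 2 := by
        rw [setIntegral_const, smul_eq_mul, measureReal_def, volume_real_ball_fin_three x₀ hr]

/-- **The approximation principle** behind every closed sub-cell of Uᶜ: for `L²` fields `uT, ut` of
`ℝ³`, `∫_{B_r(x₀)}‖uT‖² ≤ 2·∫⁻‖ut − uT‖ₑ² + 2·∫_{B_r(x₀)}‖ut‖²` (triangle inequality in `L²(B_r)` and
`(√H + √B)² ≤ 2H + 2B`). [folklore] -/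
theorem scar_le_two_clock_add_two_localMass (uT ut : EuclideanSpace ℝ (Fin 3) → EuclideanSpace ℝ (Fin 3))
    (hT : MemLp uT 2 volume) (ht : MemLp ut 2 volume) (x₀ : EuclideanSpace ℝ (Fin 3)) (r : ℝ)
    {H B : ℝ} (hH : 0 ≤ H) (hB : 0 ≤ B)
    (hmod : ∫⁻ x, ‖ut x - uT x‖ₑ ^ 2 ≤ ENNReal.ofReal H)
    (hloc : ∫ x in ball x₀ r, ‖ut x‖ ^ 2 ≤ B) :
    ∫ x in ball x₀ r, ‖uT x‖ ^ 2 ≤ 2 * H + 2 * B := by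
  set μB : Measure (EuclideanSpace ℝ (Fin 3)) := volume.restrict (ball x₀ r) with hμB
  have htri : eLpNorm uT 2 μB ≤ eLpNorm (uT - ut) 2 μB + eLpNorm ut 2 μB := by
    have h := eLpNorm_add_le (hT.1.restrict.sub ht.1.restrict) ht.1.restrict (p := 2)
      (by norm_num) (μ := μB)
    simpa only [sub_add_cancel] using h
  have hmodB : eLpNorm (uT - ut) 2 μB ≤ ENNReal.ofReal (Real.sqrt H) := by
    rw [PowerGaugeEulerLiouville.Backward.eLpNorm_two_eq_sqrt, Real.sqrt_eq_rpow,
      ← ENNReal.ofReal_rpow_of_nonneg hH (by norm_num)]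
    refine ENNReal.rpow_le_rpow ?_ (by norm_num)
    calc ∫⁻ y, ‖(uT - ut) y‖ₑ ^ 2 ∂μB ≤ ∫⁻ y, ‖(uT - ut) y‖ₑ ^ 2 :=
          lintegral_mono' Measure.restrict_le_self le_rfl
      _ = ∫⁻ y, ‖ut y - uT y‖ₑ ^ 2 := by
          refine lintegral_congr fun y => ?_
          rw [Pi.sub_apply, ← enorm_neg, neg_sub]
      _ ≤ ENNReal.ofReal H := hmod
  have hlocE : ∫⁻ y, ‖ut y‖ₑ ^ 2 ∂μB ≤ ENNReal.ofReal B := by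
    have hfin : ∫⁻ y, ‖ut y‖ₑ ^ 2 ∂μB ≠ ⊤ := by
      refine ne_top_of_le_ne_top (b := ∫⁻ y, ‖ut y‖ₑ ^ 2) ?_
        (lintegral_mono' Measure.restrict_le_self le_rfl)
      rw [lintegral_enorm_sq_eq_ofReal_integral ut ht]
      exact ENNReal.ofReal_ne_top
    rw [← ENNReal.ofReal_toReal hfin]
    refine ENNReal.ofReal_le_ofReal ?_
    rw [hμB, ← setIntegral_norm_sq_eq_toReal ut ht (ball x₀ r)]
    exact hloc
  have hsB : eLpNorm ut 2 μB ≤ ENNReal.ofReal (Real.sqrt B) := by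
    rw [PowerGaugeEulerLiouville.Backward.eLpNorm_two_eq_sqrt, Real.sqrt_eq_rpow,
      ← ENNReal.ofReal_rpow_of_nonneg hB (by norm_num)]
    exact ENNReal.rpow_le_rpow hlocE (by norm_num)
  have hsum : eLpNorm uT 2 μB ≤ ENNReal.ofReal (Real.sqrt H + Real.sqrt B) := by
    rw [ENNReal.ofReal_add (Real.sqrt_nonneg _) (Real.sqrt_nonneg _)]
    exact htri.trans (add_le_add hmodB hsB)
  have hsq : ∫⁻ y, ‖uT y‖ₑ ^ 2 ∂μB ≤ ENNReal.ofReal ((Real.sqrt H + Real.sqrt B) ^ 2) := by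
    have h := PowerGaugeEulerLiouville.Backward.lintegral_enorm_sq_le_of_eLpNorm_le hsum
    rwa [← ENNReal.ofReal_pow (add_nonneg (Real.sqrt_nonneg _) (Real.sqrt_nonneg _))] at h
  have hfinal : ∫ x in ball x₀ r, ‖uT x‖ ^ 2 ≤ (Real.sqrt H + Real.sqrt B) ^ 2 := by
    rw [setIntegral_norm_sq_eq_toReal uT hT (ball x₀ r)]
    exact ENNReal.toReal_le_of_le_ofReal (sq_nonneg _) hsq
  exact hfinal.trans (sq_sqrt_add_sqrt_le hH hB)

/-- Clocks of exponent `b ≥ 1/2` lie INSIDE Uᶜ's critical-clock class (`(T−t)^b ≤ √(T−t)` once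
`T − t ≤ 1`). [folklore] -/
theorem critClock_of_clock_ge_half {T b : ℝ} (hb : 1 / 2 ≤ b)
    {u : ℝ → EuclideanSpace ℝ (Fin 3) → EuclideanSpace ℝ (Fin 3)}
    (h : ∃ K T₁ : ℝ, T₁ < T ∧ ∀ t ∈ Ioo T₁ T,
      ∫⁻ x, ‖u t x - u T x‖ₑ ^ 2 ≤ ENNReal.ofReal (K * (T - t) ^ b)) :
    ∃ K T₁ : ℝ, T₁ < T ∧ ∀ t ∈ Ioo T₁ T,
      ∫⁻ x, ‖u t x - u T x‖ₑ ^ 2 ≤ ENNReal.ofReal (K * Real.sqrt (T - t)) := by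
  obtain ⟨K, T₁, hT₁, hK⟩ := h
  refine ⟨max K 0, max T₁ (T - 1), max_lt hT₁ (by linarith), fun t ht => ?_⟩
  have ht₁ : T₁ < t := lt_of_le_of_lt (le_max_left _ _) ht.1
  have ht1 : T - 1 < t := lt_of_le_of_lt (le_max_right _ _) ht.1
  have h0 : 0 < T - t := sub_pos.mpr ht.2
  have h1 : T - t ≤ 1 := by linarith
  refine (hK t ⟨ht₁, ht.2⟩).trans (ENNReal.ofReal_le_ofReal ?_)
  have hpow : (T - t) ^ b ≤ Real.sqrt (T - t) := by
    rw [Real.sqrt_eq_rpow]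
    exact Real.rpow_le_rpow_of_exponent_ge h0 h1 hb
  calc K * (T - t) ^ b ≤ max K 0 * (T - t) ^ b :=
        mul_le_mul_of_nonneg_right (le_max_left _ _) (Real.rpow_nonneg h0.le _)
    _ ≤ max K 0 * Real.sqrt (T - t) := mul_le_mul_of_nonneg_left hpow (le_max_right _ _)

/-- **SUP-RATE–CLOCK SCAR LAW.** On the Leray–Hopf frame (Leray–Hopf on `[0,T]` from `u 0`; only the
`L²` memberships are used), a clock of exponent `b > 0` (`‖u(t) − u(T)‖₂² ≤ K(T−t)^b` near `T`) and a
sup-norm blow-up rate of exponent `ρ > 0` (`‖u(t,x)‖ ≤ A(T−t)^{−ρ}` near `T`) give scars of order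
`α = 3b/(2ρ+b)`: `∫_{B_r(x₀)}|u(T)|² ≤ C' r^{3b/(2ρ+b)}` for small `r`, at every `x₀`
(approximation principle with the window `T − t = r^{3/(2ρ+b)}`). [folklore] -/
theorem supRateClockScarRung {ρ b : ℝ} (hρ : 0 < ρ) (hb : 0 < b) :
    ∀ (ν T : ℝ), 0 < ν → 0 < T →
    ∀ (u : ℝ → EuclideanSpace ℝ (Fin 3) → EuclideanSpace ℝ (Fin 3)),
      IsLerayHopfOn T ν 0 (u 0) u →
      (∃ K T₁ : ℝ, T₁ < T ∧ ∀ t ∈ Ioo T₁ T,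
        ∫⁻ x, ‖u t x - u T x‖ₑ ^ 2 ≤ ENNReal.ofReal (K * (T - t) ^ b)) →
      (∃ A T₃ : ℝ, T₃ < T ∧ ∀ t ∈ Ioo T₃ T, ∀ x, ‖u t x‖ ≤ A * (T - t) ^ (-ρ)) →
      ∀ x₀ : EuclideanSpace ℝ (Fin 3), ∃ C' r₁ : ℝ, 0 < r₁ ∧ ∀ r ∈ Ioo 0 r₁,
        ∫ x in ball x₀ r, ‖u T x‖ ^ 2 ≤ C' * r ^ (3 * b / (2 * ρ + b)) := by
  intro ν T _hν hT u hLH hclock hsup x₀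
  obtain ⟨K, T₁, hT₁, hK⟩ := hclock
  obtain ⟨A, T₃, hT₃, hA⟩ := hsup
  -- the window exponent `e = 3/(2ρ+b)` and the threshold
  set e : ℝ := 3 / (2 * ρ + b) with he_def
  have hden : 0 < 2 * ρ + b := by positivity
  have he : 0 < e := by positivity
  have heb : e * b = 3 * b / (2 * ρ + b) := by rw [he_def]; field_simp
  have hexp : (3 : ℝ) + e * (-ρ) * 2 = e * b := by
    rw [he_def]; field_simp; ring
  set δ : ℝ := min (T - max T₁ T₃) T / 2 with hδ_def
  have hδ : 0 < δ := by
    have : 0 < T - max T₁ T₃ := sub_pos.mpr (max_lt hT₁ hT₃)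
    positivity
  have hδ1 : δ < T - max T₁ T₃ := by
    have : min (T - max T₁ T₃) T ≤ T - max T₁ T₃ := min_le_left _ _
    have : 0 < T - max T₁ T₃ := sub_pos.mpr (max_lt hT₁ hT₃)
    linarith
  have hδT : δ < T := by
    have : min (T - max T₁ T₃) T ≤ T := min_le_right _ _
    linarith
  refine ⟨2 * max K 0 + 2 * (4 * Real.pi / 3 * A ^ 2), δ ^ (1 / e), Real.rpow_pos_of_pos hδ _,
    fun r hr => ?_⟩
  have hr0 : 0 < r := hr.1
  -- the window `τ = r^e < δ`
  set τ : ℝ := r ^ e with hτ_def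
  have hτ0 : 0 < τ := Real.rpow_pos_of_pos hr0 _
  have hτδ : τ < δ := by
    have h := Real.rpow_lt_rpow hr0.le hr.2 he
    rwa [← Real.rpow_mul hδ.le, one_div_mul_cancel he.ne', Real.rpow_one] at h
  set t : ℝ := T - τ with ht_def
  have hTt : T - t = τ := by rw [ht_def]; ring
  have ht₁ : T₁ < t := by
    have : T₁ ≤ max T₁ T₃ := le_max_left _ _
    rw [ht_def]; linarith
  have ht₃ : T₃ < t := by
    have : T₃ ≤ max T₁ T₃ := le_max_right _ _
    rw [ht_def]; linarith
  have htT : t < T := by rw [ht_def]; linarith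
  have ht0 : 0 ≤ t := by rw [ht_def]; linarith
  -- memberships
  have hmT : MemLp (u T) 2 volume := hLH.memLp T ⟨hT.le, le_rfl⟩
  have hmt : MemLp (u t) 2 volume := hLH.memLp t ⟨ht0, htT.le⟩
  -- the clock term
  have hH0 : 0 ≤ max K 0 * τ ^ b := mul_nonneg (le_max_right _ _) (Real.rpow_nonneg hτ0.le _)
  have hmod : ∫⁻ x, ‖u t x - u T x‖ₑ ^ 2 ≤ ENNReal.ofReal (max K 0 * τ ^ b) := by
    refine (hK t ⟨ht₁, htT⟩).trans (ENNReal.ofReal_le_ofReal ?_)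
    rw [hTt]
    exact mul_le_mul_of_nonneg_right (le_max_left _ _) (Real.rpow_nonneg hτ0.le _)
  -- the local mass of the smooth slice
  have hA0 : 0 ≤ A := by
    have h := hA t ⟨ht₃, htT⟩ x₀
    have hp : 0 < (T - t) ^ (-ρ) := Real.rpow_pos_of_pos (by rw [hTt]; exact hτ0) _
    nlinarith [norm_nonneg (u t x₀)]
  have hloc : ∫ x in ball x₀ r, ‖u t x‖ ^ 2 ≤ 4 * Real.pi / 3 * r ^ 3 * (A * τ ^ (-ρ)) ^ 2 := by
    have h := setIntegral_ball_norm_sq_le_of_bound (u t) hmt x₀ hr0.le (A := A * (T - t) ^ (-ρ))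
      (hA t ⟨ht₃, htT⟩)
    rwa [hTt] at h
  have hB0 : 0 ≤ 4 * Real.pi / 3 * r ^ 3 * (A * τ ^ (-ρ)) ^ 2 := by positivity
  have hmain := scar_le_two_clock_add_two_localMass (u T) (u t) hmT hmt x₀ r hH0 hB0 hmod hloc
  -- exponent bookkeeping: `τ^b = r^{eb}` and `r³(τ^{-ρ})² = r^{eb}`
  have h1 : τ ^ b = r ^ (e * b) := by rw [hτ_def, ← Real.rpow_mul hr0.le]
  have h2 : r ^ 3 * (A * τ ^ (-ρ)) ^ 2 = A ^ 2 * r ^ (e * b) := by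
    rw [hτ_def, ← Real.rpow_mul hr0.le, mul_pow, ← Real.rpow_natCast (r ^ (e * -ρ)) 2,
      ← Real.rpow_mul hr0.le, ← Real.rpow_natCast r 3, mul_comm (A ^ 2), mul_assoc,
      ← mul_assoc (r ^ ((3 : ℕ) : ℝ)), ← Real.rpow_add hr0]
    push_cast
    rw [show (3 : ℝ) + e * (-ρ * 2) = e * b by rw [← hexp]; ring]; ring
  calc ∫ x in ball x₀ r, ‖u T x‖ ^ 2
      ≤ 2 * (max K 0 * τ ^ b) + 2 * (4 * Real.pi / 3 * r ^ 3 * (A * τ ^ (-ρ)) ^ 2) := hmain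
    _ = (2 * max K 0 + 2 * (4 * Real.pi / 3 * A ^ 2)) * r ^ (3 * b / (2 * ρ + b)) := by
        rw [h1, mul_assoc (4 * Real.pi / 3), h2, heb]; ring

/-- **Critical scars from the sup-rate–clock law**: clock exponent `b` at least the sup-rate exponent
`ρ` (`0 < ρ ≤ b`) gives `r⁻¹∫_{B_r(x₀)}|u(T)|² ≤ M` for small `r` at every `x₀` (`3b/(2ρ+b) ≥ 1`).
Type I is the corner `ρ = b = 1/2`. [folklore] -/
theorem criticalScar_of_supRateClock {ρ b : ℝ} (hρ : 0 < ρ) (hρb : ρ ≤ b) :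
    ∀ (ν T : ℝ), 0 < ν → 0 < T →
    ∀ (u : ℝ → EuclideanSpace ℝ (Fin 3) → EuclideanSpace ℝ (Fin 3)),
      IsLerayHopfOn T ν 0 (u 0) u →
      (∃ K T₁ : ℝ, T₁ < T ∧ ∀ t ∈ Ioo T₁ T,
        ∫⁻ x, ‖u t x - u T x‖ₑ ^ 2 ≤ ENNReal.ofReal (K * (T - t) ^ b)) →
      (∃ A T₃ : ℝ, T₃ < T ∧ ∀ t ∈ Ioo T₃ T, ∀ x, ‖u t x‖ ≤ A * (T - t) ^ (-ρ)) →
      ∀ x₀ : EuclideanSpace ℝ (Fin 3), ∃ M r₁ : ℝ, 0 < r₁ ∧ ∀ r ∈ Ioo 0 r₁,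
        r⁻¹ * ∫ x in ball x₀ r, ‖u T x‖ ^ 2 ≤ M := by
  intro ν T hν hT u hLH hclock hsup x₀
  have hb : 0 < b := hρ.trans_le hρb
  obtain ⟨C', r₁, hr₁, hC⟩ := supRateClockScarRung hρ hb ν T hν hT u hLH hclock hsup x₀
  have hα : 1 ≤ 3 * b / (2 * ρ + b) := by
    rw [le_div_iff₀ (by positivity)]; linarith
  refine ⟨max C' 0, min r₁ 1, lt_min hr₁ one_pos, fun r hr => ?_⟩
  have hr0 : 0 < r := hr.1
  have hr1 : r ≤ 1 := hr.2.le.trans (min_le_right _ _)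
  have h1 := hC r ⟨hr0, lt_of_lt_of_le hr.2 (min_le_left _ _)⟩
  have hpow : r ^ (3 * b / (2 * ρ + b)) ≤ r := by
    have h := Real.rpow_le_rpow_of_exponent_ge hr0 hr1 hα
    rwa [Real.rpow_one] at h
  have h2 : C' * r ^ (3 * b / (2 * ρ + b)) ≤ max C' 0 * r :=
    (mul_le_mul_of_nonneg_right (le_max_left _ _) (Real.rpow_nonneg hr0.le _)).trans
      (mul_le_mul_of_nonneg_left hpow (le_max_right _ _))
  rw [inv_mul_le_iff₀ hr0]
  linarith [mul_comm (max C' 0) r]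

/-- **The literal sub-cell of U/Uᶜ on the maximal-smooth frame** («a tame first blow-up with clock
exponent `b ≥ 1/2` and sup-rate exponent `ρ ≤ b` has critical scars»): U's frame (maximal smooth
solution, Leray–Hopf on `[0,T]`, rapidly decaying datum, `L²`-tame at `T`) and conclusion VERBATIM,
plus the two rate hypotheses; by `critClock_of_clock_ge_half` its members satisfy Uᶜ's critical-clock
hypothesis. For `b ∈ (1/2, 2/3)` and `1/2 < ρ ≤ b` these MILDLY TYPE-II cells are not covered by the
energy–clock rectangle (`EnergyClockScarLaw`, needs `a ≥ 1 − b`) nor by Type I (`ρ = 1/2`). [folklore] -/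
theorem supRateClockCell {ρ b : ℝ} (hρ : 0 < ρ) (hρb : ρ ≤ b) :
    ∀ (ν T : ℝ), 0 < ν → 0 < T →
    ∀ (u : ℝ → EuclideanSpace ℝ (Fin 3) → EuclideanSpace ℝ (Fin 3))
      (p : ℝ → EuclideanSpace ℝ (Fin 3) → ℝ),
      IsMaximalSmoothSolution ν 0 u p T →
      IsLerayHopfOn T ν 0 (u 0) u →
      HasRapidSpatialDecay (u 0) →
      Tendsto (fun t => eLpNorm (u t - u T) 2 volume) (𝓝[<] T) (𝓝 0) →
      (∃ K T₁ : ℝ, T₁ < T ∧ ∀ t ∈ Ioo T₁ T,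
        ∫⁻ x, ‖u t x - u T x‖ₑ ^ 2 ≤ ENNReal.ofReal (K * (T - t) ^ b)) →
      (∃ A T₃ : ℝ, T₃ < T ∧ ∀ t ∈ Ioo T₃ T, ∀ x, ‖u t x‖ ≤ A * (T - t) ^ (-ρ)) →
      ∀ x₀ : EuclideanSpace ℝ (Fin 3), ∃ M r₁ : ℝ, 0 < r₁ ∧ ∀ r ∈ Ioo 0 r₁,
        r⁻¹ * ∫ x in ball x₀ r, ‖u T x‖ ^ 2 ≤ M :=
  fun ν T hν hT u _ _ hLH _ _ hclock hsup x₀ =>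
    criticalScar_of_supRateClock hρ hρb ν T hν hT u hLH hclock hsup x₀

end SupRateClockScarLaw

end Summit.NavierStokesRegularity.NavierStokesRegularity.Theorems
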